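import Mathlib.LinearAlgebra.Dimension.Constructions
import Mathlib.LinearAlgebra.Dimension.Finite
import Mathlib.LinearAlgebra.FiniteDimensional.Basic
import Mathlib.LinearAlgebra.LinearIndependent.Lemmas
import Literature.Computability.AlgebraicComplexity.OuterProductRank
import Literature.Computability.AlgebraicComplexity.AsymptoticSpectrum
import Literature.Computability.AlgebraicComplexity.TensorMultiples
import Literature.Computability.AlgebraicComplexity.TensorRestrictionRank
import HarnessLib

/-!
# The flattening rank `ζ⁽¹⁾` (first gauge point): `≤ R`, monotone, multiplicative — proved

Topic `Literature/Computability/AlgebraicComplexity`. The tree's `gaugePoint₁ K t`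
(`AsymptoticSpectrum.lean`, CVZ 2023 Example 1.4 / Strassen 1988 (3.10)) is the real-valued rank of
the flattening `K^ι → K^{κ×μ}` of a 3-tensor; this file introduces its `ℕ`-valued form
`flatteningRank t` (so that `gaugePoint₁ K t = flatteningRank t`, `gaugePoint₁_eq`) and PROVES the
properties used by the asymptotic-rank arguments of the `UniversalMethodBarrier` proof
(`Literature/Barriers/MatrixMultiplication/UniversalMethodBarrierAsymptoticRank.lean`): everything
over a field, finite index types where needed.

## Content

* `xSlices t` — the family of `x`-slices `a ↦ ((b,c) ↦ t a b c)`; `flatteningRank t` — the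
  dimension of their span; `gaugePoint₁_eq`.
* `flatteningRank_reindex` — invariance under relabelling (via
  `OuterProductRank.finrank_span_range_comp_linearEquiv`, `OuterProductRank.span_range_comp_of_surjective`).
* `flatteningRank_le_tensorRank` — **`ζ⁽¹⁾(t) ≤ R(t)`** (Bläser 2013, proof of Lemma 7.1(2)).
* `flatteningRank_mono` — **`t ≥ s ⇒ ζ⁽¹⁾(s) ≤ ζ⁽¹⁾(t)`** (monotonicity under restriction).
* `flatteningRank_kronecker` — **`ζ⁽¹⁾(s ⊗ t) = ζ⁽¹⁾(s) ζ⁽¹⁾(t)`** (the slices of `s ⊗ t` are the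
  outer products of the slices; rank of a Kronecker product, `OuterProductRank.finrank_span_outerFun`
  of `OuterProductRank.lean`, where the outer-product linear algebra formerly in this file now
  lives — three old names survive as aliases, see `## Aliases` at the end of the `Slices` section) —
  and `flatteningRank_kroneckerPow_zero`, `flatteningRank_kroneckerPow` — `ζ⁽¹⁾(t^{⊗N}) = ζ⁽¹⁾(t)^N`.
* `flatteningRank_multiple_matMulTensor` — `ζ⁽¹⁾(F ⊙ ⟨A,B,C⟩) = F·A·C` (`B ≥ 1`; the `FAC`
  slices are linearly independent).

These are the multiplicativity / monotonicity parts of the named fact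
`gaugePoint_isUniversalSpectralPoint` (CVZ 2023, Example 1.4) for `ζ⁽¹⁾`; additivity under direct
sums and the normalisation are not needed here and not proved.

## References

* M. Christandl, P. Vrana, J. Zuiddam, *Universal points in the asymptotic spectrum of tensors*,
  JAMS 36 (2023), Example 1.4 (gauge points). [ChristandlVranaZuiddam2023]
* M. Bläser, *Fast Matrix Multiplication*, ToC Graduate Surveys 5 (2013), proof of Lemma 7.1(2)
  (slices and rank). [Blaser2013]

## Mathlib

`finrank_span_eq_card`, `finrank_range_le_card`, `Submodule.finrank_mono`, `Submodule.finrank_map_le`,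
`LinearEquiv.funCongrLeft`, `finrank_span_singleton`; the outer-product / span-transport lemmas are
in `OuterProductRank.lean` (Mathlib-only imports, shared with `RelativeRank.lean`).
-/

noncomputable section

open scoped BigOperators
open Module Submodule

namespace Literature.Computability.AlgebraicComplexity

universe u

variable {K : Type u} [Field K]

/-! ## Slices and the flattening rank -/

section Slices

variable {ι κ μ ι' κ' μ' : Type*}

/-- The `x`-slices of `t`: `a ↦ ((b, c) ↦ t a b c)`, vectors of `K^{κ × μ}`. [folklore] -/
def xSlices (t : ι → κ → μ → K) : ι → (κ × μ → K) := fun a p => t a p.1 p.2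

omit [Field K] in
/-- Entries of slices. [folklore] -/
@[simp] theorem xSlices_apply (t : ι → κ → μ → K) (a : ι) (p : κ × μ) :
    xSlices t a p = t a p.1 p.2 := rfl

/-- The **flattening rank** `ζ⁽¹⁾(t) ∈ ℕ`: the rank of the flattening `K^ι → K^{κ × μ}`, i.e. the
dimension of the span of the `x`-slices (Strassen 1988, (3.10); CVZ 2023, Example 1.4; Bläser 2013,
proof of Lemma 7.1(2)). The tree's real-valued `gaugePoint₁ K t` is its cast (`gaugePoint₁_eq`).
[cite: ChristandlVranaZuiddam2023, Example 1.4] -/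
def flatteningRank (t : ι → κ → μ → K) : ℕ :=
  finrank K (span K (Set.range (xSlices t)))

/-- `gaugePoint₁ K t = ζ⁽¹⁾(t)` (cast to `ℝ`; index types in `Type`). [cite: ChristandlVranaZuiddam2023, Example 1.4] -/
theorem gaugePoint₁_eq {ι κ μ : Type} (t : ι → κ → μ → K) :
    gaugePoint₁ K t = (flatteningRank t : ℝ) := rfl

/-- **`ζ⁽¹⁾` is invariant under relabelling the coordinates.** [folklore] -/
theorem flatteningRank_reindex (t : ι → κ → μ → K) (e₁ : ι' ≃ ι) (e₂ : κ' ≃ κ) (e₃ : μ' ≃ μ) :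
    flatteningRank (fun a b c => t (e₁ a) (e₂ b) (e₃ c)) = flatteningRank t := by
  unfold flatteningRank
  set L : (κ × μ → K) ≃ₗ[K] (κ' × μ' → K) :=
    LinearEquiv.funCongrLeft K K (Equiv.prodCongr e₂ e₃) with hL
  have key : xSlices (fun a b c => t (e₁ a) (e₂ b) (e₃ c)) = (L ∘ xSlices t) ∘ e₁ := by
    funext a p
    rfl
  rw [key, OuterProductRank.span_range_comp_of_surjective _ e₁.surjective,
    OuterProductRank.finrank_span_range_comp_linearEquiv]

/-- **`ζ⁽¹⁾(t) ≤ R(t)`**: the slices of a sum of `r` triads lie in the span of the `r` matrices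
`u_ρ ⊗ v_ρ` (Bläser 2013, proof of Lemma 7.1(2); BCS (14.8)). [cite: Blaser2013, Lemma 7.1 (2) (proof)] -/
theorem flatteningRank_le_tensorRank [Fintype ι] [Fintype κ] [Fintype μ] (t : ι → κ → μ → K) :
    flatteningRank t ≤ tensorRank t := by
  obtain ⟨w, u, v, e⟩ := exists_triad_decomposition_tensorRank t
  set g : Fin (tensorRank t) → (κ × μ → K) := fun ρ p => u ρ p.1 * v ρ p.2 with hg
  have hle : span K (Set.range (xSlices t)) ≤ span K (Set.range g) := by
    rw [Submodule.span_le]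
    rintro _ ⟨a, rfl⟩
    have : xSlices t a = ∑ ρ, w ρ a • g ρ := by
      funext p
      rw [xSlices_apply, apply_eq_of_eq_sum_triad e, Finset.sum_apply]
      exact Finset.sum_congr rfl fun ρ _ => by simp [hg, mul_assoc]
    rw [this]
    exact Submodule.sum_mem _ fun ρ _ => Submodule.smul_mem _ _ (subset_span ⟨ρ, rfl⟩)
  calc flatteningRank t = finrank K (span K (Set.range (xSlices t))) := rfl
    _ ≤ finrank K (span K (Set.range g)) := Submodule.finrank_mono hle
    _ ≤ Fintype.card (Fin (tensorRank t)) := finrank_range_le_card g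
    _ = tensorRank t := Fintype.card_fin _

/-- **`ζ⁽¹⁾` is monotone under restriction**: `t ≥ s ⇒ ζ⁽¹⁾(s) ≤ ζ⁽¹⁾(t)` (the slices of `s`
are `A`-combinations of the images of the slices of `t` under the linear map `B ⊗ C`;
CVZ 2023, Example 1.4: gauge points are spectral points, monotonicity part). [cite: ChristandlVranaZuiddam2023, Example 1.4] -/
theorem flatteningRank_mono [Fintype ι] [Fintype κ] [Fintype μ] {t : ι → κ → μ → K}
    {s : ι' → κ' → μ' → K} (h : TensorRestrictsTo t s) : flatteningRank s ≤ flatteningRank t := by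
  obtain ⟨A, B, C, hs⟩ := h
  -- the linear map `B ⊗ C` on matrices
  set L : (κ × μ → K) →ₗ[K] (κ' × μ' → K) :=
    { toFun := fun M p => ∑ b, ∑ c, B p.1 b * C p.2 c * M (b, c)
      map_add' := fun M M' => by
        funext p
        simp only [Pi.add_apply, mul_add, Finset.sum_add_distrib]
      map_smul' := fun r M => by
        funext p
        simp only [Pi.smul_apply, smul_eq_mul, RingHom.id_apply, Finset.mul_sum]
        exact Finset.sum_congr rfl fun b _ => Finset.sum_congr rfl fun c _ => by ring } with hL
  have hle : span K (Set.range (xSlices s)) ≤ (span K (Set.range (xSlices t))).map L := by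
    rw [Submodule.span_le]
    rintro _ ⟨a', rfl⟩
    have : xSlices s a' = ∑ a, A a' a • L (xSlices t a) := by
      funext p
      rw [xSlices_apply, hs, Finset.sum_apply]
      refine Finset.sum_congr rfl fun a _ => ?_
      simp only [hL, Pi.smul_apply, LinearMap.coe_mk, AddHom.coe_mk, smul_eq_mul, xSlices_apply,
        Finset.mul_sum]
      exact Finset.sum_congr rfl fun b _ => Finset.sum_congr rfl fun c _ => by ring
    rw [this]
    exact Submodule.sum_mem _ fun a _ =>
      Submodule.smul_mem _ _ (Submodule.mem_map_of_mem (subset_span ⟨a, rfl⟩))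
  calc flatteningRank s = finrank K (span K (Set.range (xSlices s))) := rfl
    _ ≤ finrank K ((span K (Set.range (xSlices t))).map L) := Submodule.finrank_mono hle
    _ ≤ finrank K (span K (Set.range (xSlices t))) := Submodule.finrank_map_le _ _
    _ = flatteningRank t := rfl

/-! ## Multiplicativity under the Kronecker product -/

/-- **`ζ⁽¹⁾(s ⊗ t) = ζ⁽¹⁾(s) ζ⁽¹⁾(t)`** (the slices of `s ⊗ t` are, up to relabelling, the outer
products of the slices of `s` and of `t`; CVZ 2023, Example 1.4: gauge points are multiplicative).
[cite: ChristandlVranaZuiddam2023, Example 1.4] -/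
theorem flatteningRank_kronecker [Fintype ι] [Fintype κ] [Fintype μ] [Fintype ι'] [Fintype κ']
    [Fintype μ'] (s : ι → κ → μ → K) (t : ι' → κ' → μ' → K) :
    flatteningRank (kroneckerTensor s t) = flatteningRank s * flatteningRank t := by
  unfold flatteningRank
  set L : ((κ × μ) × (κ' × μ') → K) ≃ₗ[K] ((κ × κ') × (μ × μ') → K) :=
    LinearEquiv.funCongrLeft K K (Equiv.prodProdProdComm κ κ' μ μ') with hL
  have key : xSlices (kroneckerTensor s t) =
      L ∘ fun kk : ι × ι' => OuterProductRank.outerFun (xSlices s kk.1) (xSlices t kk.2) := by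
    funext kk P
    rfl
  rw [key, OuterProductRank.finrank_span_range_comp_linearEquiv, OuterProductRank.finrank_span_outerFun]

/-- `ζ⁽¹⁾` of the constant tensor `1` on one-point formats (`t^{⊗0}`) is `1`. [folklore] -/
theorem flatteningRank_kroneckerPow_zero (t : ι → κ → μ → K) :
    flatteningRank (kroneckerPow t 0) = 1 := by
  unfold flatteningRank
  have hconst : xSlices (kroneckerPow t 0) = fun _ _ => 1 := by
    funext a p
    simp [xSlices_apply, kroneckerPow_apply]
  rw [hconst]
  have hrange : Set.range (fun (_ : Fin 0 → ι) (_ : (Fin 0 → κ) × (Fin 0 → μ)) => (1 : K)) =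
      {fun _ => 1} := by
    ext f
    simp only [Set.mem_range, Set.mem_singleton_iff]
    exact ⟨fun ⟨_, h⟩ => h.symm, fun h => ⟨fun i => Fin.elim0 i, h.symm⟩⟩
  rw [hrange]
  exact finrank_span_singleton (fun h => one_ne_zero (congrFun h (fun i => Fin.elim0 i, fun i => Fin.elim0 i)))

/-- **`ζ⁽¹⁾(t^{⊗N}) = ζ⁽¹⁾(t)^N`.** [cite: ChristandlVranaZuiddam2023, Example 1.4] -/
theorem flatteningRank_kroneckerPow [Fintype ι] [Fintype κ] [Fintype μ] (t : ι → κ → μ → K)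
    (N : ℕ) : flatteningRank (kroneckerPow t N) = flatteningRank t ^ N := by
  induction N with
  | zero => rw [pow_zero, flatteningRank_kroneckerPow_zero]
  | succ N ih =>
    have key : kroneckerPow t (N + 1) = fun a b c => kroneckerTensor t (kroneckerPow t N)
        ((Fin.consEquiv fun _ => ι).symm a) ((Fin.consEquiv fun _ => κ).symm b)
        ((Fin.consEquiv fun _ => μ).symm c) := by
      rw [kroneckerPow_succ_eq]
      rfl
    rw [key, flatteningRank_reindex, flatteningRank_kronecker, ih, pow_succ, mul_comm]

/-- **`ζ⁽¹⁾(F ⊙ ⟨A,B,C⟩) = F·A·C`** (`B ≥ 1`): the `FAC` slices `x_{(f,(i,l))}` are linearly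
independent, as seen by evaluating at `(y_{(f,(i,0))}, z_{(f,(0,l))})` (Bläser 2013, proof of
Lemma 7.1(2): a matrix tensor "consists of linearly independent slices"). [cite: Blaser2013, Lemma 7.1 (2) (proof)] -/
theorem flatteningRank_multiple_matMulTensor (F A B C : ℕ) (hB : 0 < B) :
    flatteningRank (kroneckerTensor (unitTensor K F) (matMulTensor K A B C)) = F * (A * C) := by
  classical
  unfold flatteningRank
  have hli : LinearIndependent K (xSlices (kroneckerTensor (unitTensor K F) (matMulTensor K A B C))) := by
    rw [Fintype.linearIndependent_iff]
    intro g hg v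
    obtain ⟨f, i, l⟩ := v
    have := congrFun hg ((f, (i, ⟨0, hB⟩)), (f, (⟨0, hB⟩, l)))
    rw [Finset.sum_apply, Pi.zero_apply, Finset.sum_eq_single (f, (i, l))] at this
    · simpa [xSlices_apply, kroneckerTensor_unitTensor_apply, matMulTensor] using this
    · rintro ⟨f', i', l'⟩ - hne
      simp only [Pi.smul_apply, xSlices_apply, kroneckerTensor_unitTensor_apply, matMulTensor,
        smul_eq_mul, mul_eq_zero]
      right
      split_ifs with h1 h2
      · exact absurd (Prod.ext h1.1 (Prod.ext h2.1 h2.2.2)) hne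
      · rfl
      · rfl
    · simp
  rw [finrank_span_eq_card hli, Fintype.card_prod, Fintype.card_prod, Fintype.card_fin,
    Fintype.card_fin, Fintype.card_fin]


/-! ## Aliases

The outer-product / span-transport linear algebra formerly proved in this file now lives, verbatim,
in `OuterProductRank.lean` (Mathlib-only imports, shared with `RelativeRank.lean`), namespace
`Literature.Computability.AlgebraicComplexity.OuterProductRank`.
Three of the six old unqualified names are kept below as one-line aliases because importers of this
file still spell them (`FlatteningRankCube`, `KoszulFlatteningKronecker`); new code should use the
`OuterProductRank.` versions directly. -/

/-- Alias of `OuterProductRank.outerFun`, the outer product of coordinate vectors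
`(y ⊠ x)(p, q) = y p · x q` (kept for name stability; prefer the `OuterProductRank.` name). [folklore] -/
abbrev outerFun {X X' : Type*} (y : X → K) (x : X' → K) : X × X' → K :=
  OuterProductRank.outerFun y x

/-- Alias of `OuterProductRank.finrank_span_range_comp_linearEquiv`: transporting a family of
vectors along a linear equivalence does not change the dimension of its span (kept for name
stability; prefer the `OuterProductRank.` name). [folklore] -/
theorem finrank_span_range_comp_linearEquiv {V W : Type*} [AddCommGroup V] [Module K V]
    [AddCommGroup W] [Module K W] (L : V ≃ₗ[K] W) (v : ι → V) :
    finrank K (span K (Set.range (L ∘ v))) = finrank K (span K (Set.range v)) :=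
  OuterProductRank.finrank_span_range_comp_linearEquiv L v

/-- Alias of `OuterProductRank.finrank_span_outerFun`: the span of all outer products `y_i ⊠ x_j`
has dimension `dim span{y_i} · dim span{x_j}` (rank of a Kronecker product; kept for name
stability; prefer the `OuterProductRank.` name). [folklore] -/
theorem finrank_span_outerFun {X X' : Type*} [Fintype X] [Fintype X'] [Fintype ι] [Fintype ι']
    (y : ι → X → K) (x : ι' → X' → K) :
    finrank K (span K (Set.range fun kk : ι × ι' => outerFun (y kk.1) (x kk.2))) =
      finrank K (span K (Set.range y)) * finrank K (span K (Set.range x)) :=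
  OuterProductRank.finrank_span_outerFun y x

end Slices



end Literature.Computability.AlgebraicComplexity

end
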